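import Mathlib
import HarnessLib
import Summits.HubbardSuperconductivity.HubbardSuperconductivity.Theorems.KLProgrammeKLRegimeEngineValueClauseReduction
import Summits.HubbardSuperconductivity.HubbardSuperconductivity.Theorems.KLProgrammeKLRegimeSplitEngineV9

/-!
# Route `KLProgramme` — crux K3, gen-5 ENGINE child (stmt-HubbardSuperconductivity-19918 `KLRegimeEngineV14`): the value-clause reductions on the
# (E2-v9) tokens — the registered stub shapes of `stub_engine_step_values` / `stub_engine_scale0` from FOUR clauses each
# (cell gate-hubbard-kl, seat hubbard-kl-k3c2-p2)

Port of `…EngineValueClauseReduction` (klvr_, V8 tokens) to the gen-5 engine slot `EngineBoundsAtV9S` (`…SplitEngineV9`, E2-DRIVE repair):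
(E2-v9) differs from (E2-v8) only in the `1 ≤ n` budget, so (E2′-S3) ⇐ (E2″-v6) (`klvr_quarticValueIncrementAtS3_of_pairValueIncrementAtV6`) and the
scale-`0` identities transport verbatim: `klvr9_stepValuesConj_of_reduced` (the five-clause conclusion of `stub_engine_step_values` on 19918 from
(E2-v9), (E2″-v6), (E4), (E5-S)), `klvr9_scaleZeroConj_of_reduced` (the five-clause conclusion of `stub_engine_scale0` from (E1-v4)₀, the
pair-amplitude UV clause, (E4)₀, (E5-S)₀), `klvr9_engineBoundsAtV9S_of_clauses` / `_iff` (the slot's exact analytic content at every scale: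
(E1-v4) ∧ (E2-v9) ∧ (E2″-v6) ∧ (E4) ∧ (E5-S)).  Bookkeeping only; nothing about the model is asserted.
-/

noncomputable section

namespace Summit.HubbardSuperconductivity.HubbardSuperconductivity.Theorems.KLRegimeSplit

set_option linter.dupNamespace false -- summit = problem name (single-conjunct summit), D-0017

open Real Finset Literature.MathematicalPhysics.QuantumLattice Literature.Probability.LatticeModels
open Summit.HubbardSuperconductivity.HubbardSuperconductivity.Theorems.KLProgrammeLegKernels

section Model

variable {L M : ℕ} [NeZero L] [NeZero M]

/-- (E2′-S2 UV) from (E2-v9): the `n = 0` conjuncts coincide (as for V8). -/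
theorem klvr9_quarticValueUVAtS2_of_pairLadderStepAtV9 {G : GeoConsts} {P : SplitConsts} {Q : EngConsts} {β U μ : ℝ} {K : TrigPolyC4v}
    {n : ℕ} (h : PairLadderStepAtV9 L M G P Q β U μ K n) : QuarticValueUVAtS2 L M G P Q β U μ K n := by
  intro h0
  subst h0
  exact quarticValueUVAtS2_zero_of_pairAmplitudeUVClause (h.1 rfl) rfl

/-- **The registered stub's shape at the inductive scales on 19918** (`stub_engine_step_values` concludes
`PairLadderStepAtV9 … n ∧ PairValueIncrementAtV6 … n ∧ QuarticValueIncrementAtS3 … n ∧ EngineFirstMoments … n ∧ IsoTupleL1AtS … n`): that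
five-clause conjunction from the FOUR clauses without (E2′-S3). -/
theorem klvr9_stepValuesConj_of_reduced {G : GeoConsts} {P : SplitConsts} {Q : EngConsts} {β U μ : ℝ} {K : TrigPolyC4v} {n : ℕ}
    (hE2 : PairLadderStepAtV9 L M G P Q β U μ K n) (hE2'' : PairValueIncrementAtV6 L M G P Q β U μ K n)
    (hE4 : EngineFirstMoments L M G P Q β U μ K n) (hE5 : IsoTupleL1AtS L M G P β U μ K n) :
    PairLadderStepAtV9 L M G P Q β U μ K n ∧ PairValueIncrementAtV6 L M G P Q β U μ K n ∧
      QuarticValueIncrementAtS3 L M G P Q β U μ K n ∧ EngineFirstMoments L M G P Q β U μ K n ∧ IsoTupleL1AtS L M G P β U μ K n :=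
  ⟨hE2, hE2'', klvr_quarticValueIncrementAtS3_of_pairValueIncrementAtV6 hE2'', hE4, hE5⟩

/-- **The registered stub's shape at scale `0` on 19918** (`stub_engine_scale0` concludes
`KernelNormsV4 … 0 ∧ PairLadderStepAtV9 … 0 ∧ QuarticValueUVAtS2 … 0 ∧ EngineFirstMoments … 0 ∧ IsoTupleL1AtS … 0`): that five-clause conjunction
from the FOUR analytic clauses (E1-v4)₀, the pair-amplitude ultraviolet clause, (E4)₀, (E5-S)₀. -/
theorem klvr9_scaleZeroConj_of_reduced {G : GeoConsts} {P : SplitConsts} {Q : EngConsts} {β U μ : ℝ} {K : TrigPolyC4v}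
    (hE1 : KernelNormsV4 L M P Q β U μ K 0)
    (hUV : ∀ Qm : TorusSite 2 L, ∀ k ∈ klBall L μ K, ∀ k' ∈ klBall L μ K,
      ‖klPairAmplitude L M β U μ K 0 Qm k k' - (U : ℂ)‖ ≤ initDevBar G U + legDressBarQ G P Q U 0 4)
    (hE4 : EngineFirstMoments L M G P Q β U μ K 0) (hE5 : IsoTupleL1AtS L M G P β U μ K 0) :
    KernelNormsV4 L M P Q β U μ K 0 ∧ PairLadderStepAtV9 L M G P Q β U μ K 0 ∧ QuarticValueUVAtS2 L M G P Q β U μ K 0 ∧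
      EngineFirstMoments L M G P Q β U μ K 0 ∧ IsoTupleL1AtS L M G P β U μ K 0 := by
  obtain ⟨h1, h2, h3, h4, h5⟩ := klvr_scaleZeroConjV8_of_reduced (L := L) (M := M) hE1 hUV hE4 hE5
  exact ⟨h1, (pairLadderStepAtV9_iff_V8_zero G P Q β U μ K).2 h2, h3, h4, h5⟩

/-- **At every scale, (E0), (E2′-S3) and (E2′-S2 UV) are never owed on the V9S slot**: `EngineBoundsAtV9S … n` from the five remaining clauses. -/
theorem klvr9_engineBoundsAtV9S_of_clauses {G : GeoConsts} {P : SplitConsts} {Q : EngConsts} {β U μ : ℝ} {K : TrigPolyC4v} {n : ℕ}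
    (hE1 : KernelNormsV4 L M P Q β U μ K n) (hE2 : PairLadderStepAtV9 L M G P Q β U μ K n)
    (hE2'' : PairValueIncrementAtV6 L M G P Q β U μ K n)
    (hE4 : EngineFirstMoments L M G P Q β U μ K n) (hE5 : IsoTupleL1AtS L M G P β U μ K n) :
    EngineBoundsAtV9S L M G P Q β U μ K n :=
  ⟨selfEnergySymmetric_all L M β U μ K n, hE1, hE2, hE2'', klvr_quarticValueIncrementAtS3_of_pairValueIncrementAtV6 hE2'',
    klvr9_quarticValueUVAtS2_of_pairLadderStepAtV9 hE2, hE4, hE5⟩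

/-- **The V9S slot's exact analytic content, all scales**: `EngineBoundsAtV9S … n ↔ (E1-v4) ∧ (E2-v9) ∧ (E2″-v6) ∧ (E4) ∧ (E5-S)`. -/
theorem klvr9_engineBoundsAtV9S_iff (G : GeoConsts) (P : SplitConsts) (Q : EngConsts) (β U μ : ℝ) (K : TrigPolyC4v) (n : ℕ) :
    EngineBoundsAtV9S L M G P Q β U μ K n ↔
      KernelNormsV4 L M P Q β U μ K n ∧ PairLadderStepAtV9 L M G P Q β U μ K n ∧ PairValueIncrementAtV6 L M G P Q β U μ K n ∧
        EngineFirstMoments L M G P Q β U μ K n ∧ IsoTupleL1AtS L M G P β U μ K n := by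
  constructor
  · exact fun h => ⟨h.2.1, h.2.2.1, h.2.2.2.1, h.2.2.2.2.2.2.1, h.2.2.2.2.2.2.2⟩
  · exact fun h => klvr9_engineBoundsAtV9S_of_clauses h.1 h.2.1 h.2.2.1 h.2.2.2.1 h.2.2.2.2

end Model

end Summit.HubbardSuperconductivity.HubbardSuperconductivity.Theorems.KLRegimeSplit

end
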